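import Literature.Topology.FourManifolds.TubularNbhdOfLocalDiffeomorph
import Literature.Topology.FourManifolds.SmoothEmbeddingComp
import Literature.Topology.FourManifolds.KirbyMovesShrinkProofs
import Mathlib.Analysis.Normed.Module.Ball.Homeomorph
import HarnessLib

/-!
# Squeezing an oriented tubular neighbourhood of a knot into a thin tube

Topic `Literature/Topology/FourManifolds`; general infrastructure (written for the fact seat
`provefact-Literature.Topology.FourManifolds.FramedLink.IsStrictHandleSlide.slideModel`, Kirby
(1989), Ch. I §4: the transported tubes of the handle slide have to be thin to be pulled back
from the surgered manifold to `S³`, `Knot.TubularNbhd.exists_pullback`, `KirbyMovesSlideTubes.lean`).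

* `Literature.Topology.FourManifolds.Knot.TubularNbhd.squeeze μ r hr` — **the squeezed tubular
  neighbourhood** `μ ∘ (id × σ_r)`, `σ_r (w) = r w / √(1 + ‖w‖²)` the tree's radial diffeomorphism
  of `ℝ²` onto the open disc `D̊²_r` (`squeeze r`, `DehnSurgeryTubularNbhdProofs.lean`; equal to
  Mathlib's `OpenPartialHomeomorph.univBall 0 r`): again an oriented tubular neighbourhood of the
  same knot, whose whole image is the thin open tube `μ(S¹ × D̊²_r)` (`range_squeeze`). Smoothness:
  a smooth embedding precomposed with a globally defined partial diffeomorphism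
  (`Manifold.IsSmoothEmbedding.comp_openPartialHomeomorph`); orientation: the Jacobian frame
  determinant is `det (Dσ_r) > 0` times that of `μ` (`tubeFrameDet_comp_squeeze`, the chain
  rule of `tubeFrameDet_tubeδ` for an arbitrary tube). Hirsch, *Differential Topology* (1976),
  Ch. 4 §5 ("a partial tubular neighbourhood contains a full one"); Kosinski (1993), III.3. The
  tree's `TwoKnot.TubularNbhd.squeeze` (`GluckTwistLocality.lean`) is the same construction for
  2-knots in `S⁴` (no orientation condition there).

Everything here is proved; no named fact is introduced.

## References

* M. W. Hirsch, *Differential Topology*, GTM 33, Springer (1976), Ch. 4 §5, Thm. 5.1.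
  [cite: Hirsch1976, §4.5 Thm 5.1]
* A. A. Kosinski, *Differential Manifolds*, Academic Press (1993), Ch. III §3. [Kosinski1993]
-/

open scoped Manifold ContDiff Topology
open Function Set Metric

noncomputable section

namespace Literature.Topology.FourManifolds

/-- Local notation: `𝔼 n` is the model Euclidean space `EuclideanSpace ℝ (Fin n)`. -/
local notation "𝔼 " n:arg => EuclideanSpace ℝ (Fin n)

/-- Local notation: `𝕊 n` is the unit sphere in `EuclideanSpace ℝ (Fin (n + 1))`. -/
local notation "𝕊 " n:arg => (Metric.sphere (0 : EuclideanSpace ℝ (Fin (n + 1))) 1)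

attribute [local instance] fact_finrank_euclideanSpace_two fact_finrank_euclideanSpace_four

/-! ### The fibrewise squeeze of `S¹ × ℝ²` -/

section FibreSqueeze

variable {r : ℝ}

/-- Mathlib's radial diffeomorphism `OpenPartialHomeomorph.univBall 0 r : ℝ² → D̊²_r` (`r > 0`) is
the tree's squeeze map `σ_r (w) = r w / √(1 + ‖w‖²)`. [folklore] -/
theorem univBall_zero_eq_squeeze (hr : 0 < r) (w : 𝔼 2) :
    OpenPartialHomeomorph.univBall (0 : 𝔼 2) r w = squeeze r w := by
  rw [OpenPartialHomeomorph.univBall, dif_pos hr, OpenPartialHomeomorph.trans'_apply,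
    OpenPartialHomeomorph.unitBallBall_apply, OpenPartialHomeomorph.univUnitBall_apply, squeeze_def,
    squeezeFactor_def, smul_smul, vadd_eq_add, add_zero]

variable (r) in
/-- **The fibrewise squeeze** `(x, w) ↦ (x, r w / √(1 + ‖w‖²))` of `S¹ × ℝ²` onto the open tube
`S¹ × D̊²_r`, as a partial homeomorphism defined everywhere (the identity on the circle times
Mathlib's `OpenPartialHomeomorph.univBall 0 r`). [folklore] -/
def circleFibreSqueeze : OpenPartialHomeomorph ((𝕊 1) × 𝔼 2) ((𝕊 1) × 𝔼 2) :=
  (OpenPartialHomeomorph.refl (𝕊 1)).prod (OpenPartialHomeomorph.univBall (0 : 𝔼 2) r)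

/-- The fibrewise squeeze on points. [folklore] -/
@[simp] theorem circleFibreSqueeze_apply (p : (𝕊 1) × 𝔼 2) :
    circleFibreSqueeze r p = (p.1, OpenPartialHomeomorph.univBall (0 : 𝔼 2) r p.2) := rfl

/-- The fibrewise squeeze is defined everywhere. [folklore] -/
@[simp] theorem circleFibreSqueeze_source : (circleFibreSqueeze r).source = univ := by
  simp [circleFibreSqueeze]

/-- The image of the fibrewise squeeze is the open tube of radius `r`. [folklore] -/
theorem circleFibreSqueeze_target (hr : 0 < r) :
    (circleFibreSqueeze r).target = univ ×ˢ ball (0 : 𝔼 2) r := by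
  simp [circleFibreSqueeze, OpenPartialHomeomorph.univBall_target _ hr]

/-- The fibrewise squeeze is smooth. [folklore] -/
theorem contMDiffOn_circleFibreSqueeze :
    ContMDiffOn ((𝓡 1).prod 𝓘(ℝ, 𝔼 2)) ((𝓡 1).prod 𝓘(ℝ, 𝔼 2)) ∞ (circleFibreSqueeze r)
      (circleFibreSqueeze r).source := by
  have h : ContMDiff ((𝓡 1).prod 𝓘(ℝ, 𝔼 2)) ((𝓡 1).prod 𝓘(ℝ, 𝔼 2)) ∞
      (fun p : (𝕊 1) × 𝔼 2 => (p.1, OpenPartialHomeomorph.univBall (0 : 𝔼 2) r p.2)) :=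
    contMDiff_fst.prodMk
      ((OpenPartialHomeomorph.contDiff_univBall (n := ⊤)).contMDiff.comp contMDiff_snd)
  exact h.contMDiffOn

/-- The inverse of the fibrewise squeeze is smooth on the open tube. [folklore] -/
theorem contMDiffOn_circleFibreSqueeze_symm (hr : 0 < r) :
    ContMDiffOn ((𝓡 1).prod 𝓘(ℝ, 𝔼 2)) ((𝓡 1).prod 𝓘(ℝ, 𝔼 2)) ∞ (circleFibreSqueeze r).symm
      (circleFibreSqueeze r).target := by
  rw [circleFibreSqueeze_target hr]
  have h1 : ContMDiffOn ((𝓡 1).prod 𝓘(ℝ, 𝔼 2)) 𝓘(ℝ, 𝔼 2) ∞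
      (fun p : (𝕊 1) × 𝔼 2 => (OpenPartialHomeomorph.univBall (0 : 𝔼 2) r).symm p.2)
      (univ ×ˢ ball (0 : 𝔼 2) r) :=
    (OpenPartialHomeomorph.contDiffOn_univBall_symm (n := ⊤) (c := (0 : 𝔼 2)) (r := r)).contMDiffOn.comp
      contMDiff_snd.contMDiffOn fun p hp => hp.2
  exact (contMDiff_fst.contMDiffOn.prodMk h1).congr fun p _ => rfl

end FibreSqueeze

/-! ### The frame determinant of a squeezed tube -/

section FrameDet

variable {G : ℝ × 𝔼 2 → 𝔼 4}

/-- **Chain rule for a squeezed tube**: for `G_r (θ, w) = G (θ, σ_r w)`,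
`DG_r (θ, w) = DG (θ, σ_r w) ∘ (id × Dσ_r (w))`. [folklore] -/
theorem hasFDerivAt_comp_squeeze (hG : Differentiable ℝ G) (r θ : ℝ) (w : 𝔼 2) :
    HasFDerivAt (fun q : ℝ × 𝔼 2 ↦ G (q.1, squeeze r q.2))
      ((fderiv ℝ G (θ, squeeze r w)).comp ((ContinuousLinearMap.fst ℝ ℝ (𝔼 2)).prod
        ((squeezeFDeriv r w).comp (ContinuousLinearMap.snd ℝ ℝ (𝔼 2))))) (θ, w) := by
  have h2 : HasFDerivAt (squeeze r ∘ Prod.snd)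
      ((squeezeFDeriv r w).comp (ContinuousLinearMap.snd ℝ ℝ (𝔼 2))) (θ, w) :=
    (hasFDerivAt_squeeze r w).comp (θ, w) hasFDerivAt_snd
  have h1 := (hasFDerivAt_fst (p := (θ, w))).prodMk h2
  exact (hG _).hasFDerivAt.comp (θ, w) h1

/-- **Jacobian frame determinant of a squeezed tube**:
`det (G_r, ∂G_r) (θ, w) = det (Dσ_r w) · det (G, ∂G) (θ, σ_r w)` (the pattern of the tree's
`tubeFrameDet_tubeδ`, for an arbitrary differentiable `G : ℝ × ℝ² → ℝ⁴`). [folklore] -/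
theorem tubeFrameDet_comp_squeeze (hG : Differentiable ℝ G) (r θ : ℝ) (w : 𝔼 2) :
    tubeFrameDet (fun q : ℝ × 𝔼 2 ↦ G (q.1, squeeze r q.2)) (θ, w) =
      (squeezeMatrix r w 0 0 * squeezeMatrix r w 1 1 - squeezeMatrix r w 0 1 * squeezeMatrix r w 1 0)
        * tubeFrameDet G (θ, squeeze r w) := by
  rw [tubeFrameDet_def, tubeFrameDet_def, (hasFDerivAt_comp_squeeze hG r θ w).fderiv]
  simp only [ContinuousLinearMap.comp_apply, ContinuousLinearMap.prod_apply,
    ContinuousLinearMap.coe_fst', ContinuousLinearMap.coe_snd', map_zero, squeezeFDeriv_single_eq]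
  set L := fderiv ℝ G (θ, squeeze r w)
  have hlin : ∀ a b : ℝ, L (0, a • EuclideanSpace.single 0 (1 : ℝ) + b • EuclideanSpace.single 1 (1 : ℝ))
      = a • L (0, EuclideanSpace.single 0 1) + b • L (0, EuclideanSpace.single 1 1) := by
    intro a b
    rw [← map_smul, ← map_smul, ← map_add]
    congr 1
    ext <;> simp
  rw [hlin, hlin, frameDet_comb₂]

end FrameDet

/-! ### The squeezed tubular neighbourhood -/

namespace Knot.TubularNbhd

variable {K : 𝕊 1 → 𝕊 3} (μ : Knot.TubularNbhd K) (r : ℝ)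

/-- The squeezed tube as a bare function `(x, w) ↦ μ (x, σ_r w)`. [folklore] -/
def squeezeFun (q : (𝕊 1) × 𝔼 2) : 𝕊 3 := μ (q.1, Literature.Topology.FourManifolds.squeeze r q.2)

/-- Unfolding of `squeezeFun`. [folklore] -/
theorem squeezeFun_apply (q : (𝕊 1) × 𝔼 2) :
    μ.squeezeFun r q = μ (q.1, Literature.Topology.FourManifolds.squeeze r q.2) := rfl

/-- The squeezed tube is `μ` precomposed with the fibrewise squeeze. [folklore] -/
theorem squeezeFun_eq_comp {r : ℝ} (hr : 0 < r) : μ.squeezeFun r = ⇑μ ∘ circleFibreSqueeze r := by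
  funext q
  rw [squeezeFun_apply, comp_apply, circleFibreSqueeze_apply, univBall_zero_eq_squeeze hr]

/-- The squeezed tube is smooth. [folklore] -/
theorem contMDiff_squeezeFun : ContMDiff ((𝓡 1).prod 𝓘(ℝ, 𝔼 2)) (𝓡 3) ∞ (μ.squeezeFun r) :=
  μ.contMDiff.comp (contMDiff_fst.prodMk ((contDiff_squeeze r).contMDiff.comp contMDiff_snd))

/-- The squeezed tube is a smooth embedding (`μ` precomposed with the globally defined partial
diffeomorphism `circleFibreSqueeze r`). [folklore] -/
theorem isSmoothEmbedding_squeezeFun {r : ℝ} (hr : 0 < r) :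
    Manifold.IsSmoothEmbedding ((𝓡 1).prod 𝓘(ℝ, 𝔼 2)) (𝓡 3) ∞ (μ.squeezeFun r) := by
  rw [μ.squeezeFun_eq_comp hr]
  exact μ.isSmoothEmbedding_coe.comp_openPartialHomeomorph (circleFibreSqueeze r)
    circleFibreSqueeze_source contMDiffOn_circleFibreSqueeze (contMDiffOn_circleFibreSqueeze_symm hr)

/-- The coordinate expression of the squeezed tube is that of `μ`, squeezed. [folklore] -/
theorem coordOf_squeezeFun :
    coordOf (μ.squeezeFun r) = fun q : ℝ × 𝔼 2 ↦ coordOf ⇑μ (q.1, squeeze r q.2) := rfl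

/-- The frame determinant of the squeezed tube is positive: it is `det (Dσ_r) > 0` times that of
`μ`. [folklore] -/
theorem tubeFrameDet_coordOf_squeezeFun_pos {r : ℝ} (hr : 0 < r) (q : ℝ × 𝔼 2) :
    0 < tubeFrameDet (coordOf (μ.squeezeFun r)) q := by
  obtain ⟨θ, w⟩ := q
  rw [coordOf_squeezeFun,
    tubeFrameDet_comp_squeeze ((contDiff_coordOf μ.contMDiff).differentiable (by simp))]
  exact mul_pos (squeezeMatrix_det_pos hr w) (μ.tubeFrameDet_paramCoe_pos (θ, squeeze r w))

variable {r} (hr : 0 < r)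

/-- **The squeezed tubular neighbourhood** `μ.squeeze r = μ ∘ (id × σ_r)`,
`σ_r (w) = r w / √(1 + ‖w‖²)`: an oriented tubular neighbourhood of the same knot whose image is the
thin open tube `μ(S¹ × D̊²_r)` (`range_squeeze`). It is a smooth embedding as `μ` precomposed with
the globally defined partial diffeomorphism `circleFibreSqueeze r`
(`Manifold.IsSmoothEmbedding.comp_openPartialHomeomorph`), and positively oriented because its
Jacobian frame determinant is `det (Dσ_r) > 0` times that of `μ`
(`tubeFrameDet_coordOf_squeezeFun_pos`). Hirsch (1976), Ch. 4 §5, Thm. 5.1 ("a partial tubular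
neighbourhood contains a full one"). [cite: Hirsch1976, §4.5 Thm 5.1] -/
def squeeze : Knot.TubularNbhd K where
  toFun := μ.squeezeFun r
  isSmoothEmbedding := μ.isSmoothEmbedding_squeezeFun hr
  apply_zero x := by
    rw [squeezeFun_apply, squeeze_zero, μ.coe_apply_zero]
  det_pos := det_pos_of_tubeFrameDet_pos (μ.contMDiff_squeezeFun r)
    (μ.tubeFrameDet_coordOf_squeezeFun_pos hr)

/-- The squeezed tubular neighbourhood on points. [folklore] -/
@[simp] theorem squeeze_apply (q : (𝕊 1) × 𝔼 2) :
    μ.squeeze hr q = μ (q.1, Literature.Topology.FourManifolds.squeeze r q.2) := rfl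

/-- **The image of the squeezed tubular neighbourhood is the thin open tube** `μ(S¹ × D̊²_r)`.
[folklore] -/
theorem range_squeeze : range ⇑(μ.squeeze hr) = ⇑μ '' (univ ×ˢ ball (0 : 𝔼 2) r) := by
  apply Set.eq_of_subset_of_subset
  · rintro _ ⟨⟨x, w⟩, rfl⟩
    exact ⟨(x, _), ⟨mem_univ _, mem_ball_zero_iff.2 (norm_squeeze_lt hr w)⟩, rfl⟩
  · rintro _ ⟨⟨x, v⟩, ⟨-, hv⟩, rfl⟩
    refine ⟨(x, (OpenPartialHomeomorph.univBall (0 : 𝔼 2) r).symm v), ?_⟩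
    rw [squeeze_apply, ← univBall_zero_eq_squeeze hr,
      (OpenPartialHomeomorph.univBall (0 : 𝔼 2) r).right_inv
        (by rw [OpenPartialHomeomorph.univBall_target _ hr]; exact hv)]

/-- The image of the squeezed tubular neighbourhood lies in the image of `μ`. [folklore] -/
theorem range_squeeze_subset : range ⇑(μ.squeeze hr) ⊆ range ⇑μ := by
  rw [range_squeeze]; exact image_subset_range _ _

/-- The squeeze fixes the fibre directions: `μ.squeeze r (x, w) = μ (x, t • w)` with `0 < t`.
[folklore] -/
theorem squeeze_apply_eq_smul (x : 𝕊 1) (w : 𝔼 2) :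
    ∃ t : ℝ, 0 < t ∧ μ.squeeze hr (x, w) = μ (x, t • w) :=
  ⟨r * squeezeFactor w, mul_pos hr (squeezeFactor_pos w), rfl⟩

end Knot.TubularNbhd

end Literature.Topology.FourManifolds
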